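import Literature.NumberTheory.LFunctions.Zhang2022.PartIIConstraints

/-!
# Zhang (2022) Part II (§§7–12) constraint layer — version 2: two conjuncts added, v1 untouched

Trunk T-ANT (NumberTheory/LFunctions). Y. Zhang, *Discrete mean estimates and the Landau–Siegel
zero*, arXiv:2211.02515v1 (2022) [Zhang2022LandauSiegel] — an unrefereed manuscript under
adjudication (cell pub-zhang: audit + repair census of arXiv:2211.02515; **no claim about
Landau–Siegel**). **Nothing in this file asserts or denies its Theorems 1–2, its Propositions or
any of its analytic lemmas.** It is the Lean face of version `part2-v2` of the cell's Part-II
constraint census (`constraints/part2.json`, which supersedes `part2-v1` = the face of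
`PartIIConstraints.AdmissibleII`): the v1 conjunction is KEPT verbatim and two parameter relations
that v1 did not encode are ADDED as `PartIIDesign.ExtraV2`, following two report-only notes of the
cell's Part-II typer (N1, S2) and the A=B cross-check of the two faces:

* `kP < keps` [cell rows X-II.eps.b ← G-eps.d]: `ε = exp(−c𝓛^{keps})` beats every polynomial loss
  `P^{O(1)} = exp(O(𝓛^{kP}))` that multiplies an `O(ε)` in §§7–12 ((7.6)–(7.9) summed over `ψ mod p`,
  `p ∼ P`; §8's `I₁ = Ĩ₁⁺ − Ĩ₁⁻ + O(ε)` over `ψ ∈ Ψ₁`; Lemma 11.1's off-window `≪ ε` over `n < P`):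
  `9 < 10` as printed. (v1's `keps ≤ kP + kT` is a different row — the tail `m ≥ P²` of (7.3) with the
  segment moved to `𝔧(𝓛^{kP})`, gain `(T^{gS}/t₀)^{𝓛^{kP}}` [II-7.04br1] — and stays.)
* `kE2 ≤ w ∧ kE2 ≤ k0 − k1` [cell row II-L11.2a]: the prefactor `𝓛^{-kE2} = 𝓛^{-68}` of `E₂` in
  Lemma 11.2 is produced "in a way similar to the proof of Lemma 6.1", i.e. through (5.4), whose
  `𝓛^{-68}` is `min(w, k0 − k1) = min(68, 114)` (`p < P(1+𝓛^{-w})`, `t = 2πt₀(1 + O(𝓛₁/t₀))`): `kE2` is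
  not a free exponent. Inequality form, since `E₂ ≪ 𝓛^{-kE2}(…)` is an upper bound.

Main statements: `printedII_admissibleV2` (the printed design satisfies v2), `admissibleV2_withA_iff`
(with everything else printed, v2 is admissible iff `15 ≤ A`, exactly as v1: Part II still does not
bind `A = 2022`), `admissibleIIv2_le` (v2 ⇒ v1, so every v1 consequence transfers) and
`not_claimedNumericFace_printedII_v2` (the numerical face still fails at the printed design: (8.24)).
All proofs are decidable arithmetic on the literals of `printedII`.
-/

noncomputable section

namespace Literature.NumberTheory.LFunctions.Zhang2022

namespace PartIIDesign

/-- The two v2 rows [X-II.eps.b, II-L11.2a]: `ε` beats `P^{O(1)}` (`kP < keps`), and `E₂`'s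
prefactor exponent is bounded by the prime-window exponent and by the `t ↦ t₀` replacement error
(`kE2 ≤ w`, `kE2 ≤ k0 − k1`). [cite: Zhang2022LandauSiegel, §4 (ε), (5.4), §7 (7.6)–(7.9), Lemma 11.1, Lemma 11.2] -/
def ExtraV2 (p : PartIIDesign) : Prop :=
  p.kP < p.keps ∧ p.kE2 ≤ p.w ∧ p.kE2 ≤ p.k0 - p.k1

/-- `AdmissibleIIv2 p`: version 2 of the Part II row conjunction = v1 (`AdmissibleII`, unchanged)
and `ExtraV2`. [cite: Zhang2022LandauSiegel, §§7–12] -/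
def AdmissibleIIv2 (p : PartIIDesign) : Prop :=
  p.AdmissibleII ∧ p.ExtraV2

/-- v2 refines v1: every consequence of `AdmissibleII` holds under `AdmissibleIIv2`. [folklore] -/
theorem admissibleIIv2_le (p : PartIIDesign) : p.AdmissibleIIv2 → p.AdmissibleII :=
  fun h => h.1

/-- The printed design satisfies the two added rows (`9 < 10`, `68 ≤ 68`, `68 ≤ 519 − 405`). [folklore] -/
theorem printedII_extraV2 : printedII.ExtraV2 := by
  norm_num [ExtraV2, printedII]

/-- The printed design satisfies every v2 row. [folklore] -/
theorem printedII_admissibleV2 : printedII.AdmissibleIIv2 :=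
  ⟨printedII_admissible, printedII_extraV2⟩

/-- On the printed design the window row holds with equality in its first clause (`kE2 = w = 68`):
a sweep that moves `w` below `68` must lower `kE2` with it. [folklore] -/
theorem printedII_kE2_eq_w : printedII.kE2 = printedII.w := by
  norm_num [printedII]

/-- With every other parameter as printed, the v2 rows are admissible iff `15 ≤ A` — the same
threshold as v1 (`admissible_withA_iff`): the added rows do not mention `A0`. [folklore] -/
theorem admissibleV2_withA_iff (a : ℝ) :
    ({ printedII with A0 := a } : PartIIDesign).AdmissibleIIv2 ↔ 15 ≤ a := by
  constructor
  · rintro ⟨h, -⟩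
    exact (admissible_withA_iff a).1 h
  · intro ha
    refine ⟨(admissible_withA_iff a).2 ha, ?_⟩
    norm_num [ExtraV2, printedII]

/-- The numerical face of Part II still fails at the printed design under v2 (the design is
v2-admissible and (8.24) is certified false): restatement of
`not_claimedNumericFace_printedII` for the v2 conjunction. [folklore] -/
theorem not_claimedNumericFace_printedII_v2 :
    ¬ (printedII.AdmissibleIIv2 →
        Ineq824 ∧ Ineq98c ∧ Ineq10a ∧ Ineq10b ∧ Ineq10c ∧ Prop24Main ∧ Ineq233) :=
  fun h => not_numericClosingPartII (h printedII_admissibleV2)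

end PartIIDesign

end Literature.NumberTheory.LFunctions.Zhang2022
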